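import Summits.QuantumFields.BalabanUV.Beta.SymBorderedHessianResidualDressing
import Summits.QuantumFields.BalabanUV.Beta.BorderedHessianBlind

/-!
# `BalabanUV.Beta.SymBorderedHessianBlind` — binder row D1, JSB12SYM-SPINE v1.1 (Σ3) step K2 part d: THE BORDERED HESSIAN IS BLIND TO THE
# SYMMETRISED DRESSING — `bhK N ∘ Π̂_sym = bhK N` and `Π̂ᵀ_sym ∘ bhK N = bhK N` (pattern `BorderedHessianBlind` verbatim: `curv ∘ Π^{sym}_bm = curv`,
# S1f `contourSum_symAxProjBmAt`, the column action `comp_bhK_inl∕inr` and the sign symmetry `trK (bhK N) = sgnK (bhK N)` BY NAME)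

CHART (RULING R-D1-g25-4): chart (II); hSX separate.
HONEST FRAMING (cell contract, verbatim): «discharging `BetaPertH` makes Bałaban's UV stability UNCONDITIONAL — a real constructive-QFT
result; it is NOT the continuum limit and NOT the Clay problem.»  THIS MODULE DISCHARGES NOTHING of `BetaPertH` ∕ row D1: [folklore] bookkeeping
of OUR objects.  0 sorry, 0 `def … : Prop`, nothing cited.  NOT HERE (K2 part e): the `RelInv` assembly.  NOT D1, NOT BetaPertH, NOT continuum, NOT Clay.
HONEST DEPENDENCY (verbatim): «continuum YM on T⁴ ⇐ BetaPertH ∧ nine spine estimates (0/9 proved); BetaPertH ⇐ (D1) ∧ (D4) ∧ CAP+tail;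
G-an2-4 gates asym, D1 and NE2/3/4.»  ABSOLUTE RULE (cell, verbatim): «No internally-minted statement may enter as a cited fact. Every
hypothesis is either kernel-proved in this package or a verbatim quotation of a PUBLISHED theorem with page reference.»
Unit `b2b-balaban-beta-an2` gen 25 (row-D1 owner), 2026-08-21.
-/

namespace Summit.QuantumFields.BalabanUV.Beta.SymBorderedHessianBlind

noncomputable section

open Finset
open scoped BigOperators Nat
open Literature.Probability.LatticeModels (TorusSite Torus.proj Torus.proj_apply)
open Literature.MathematicalPhysics.QuantumFieldTheory
open Literature.MathematicalPhysics.QuantumFieldTheory.Balaban1983to89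
open Literature.MathematicalPhysics.QuantumFieldTheory.Balaban1983to89.Beta
open ExpKernelCalculus (MKer comp)
open AffineAveraging (Form0 Form1 Form2 Site box toSite unitVec unitVec_apply dz curv curvAdj codiff₁ contourSum curv_dz)
open AffineReproduction (contourSumAdj curv_sub curvAdj_zero)
open LatticeForm (quo)
open KKTFluctuationKernel (delta1 delta1_apply)
open AveragingContours (grad grad_eq_dz)
open AveragingContoursRooted (ctr ctrOff ctrOff_mem_box)
open OneStepResolventKernel (Fib quo_zsmul eq_zsmul_quo_of_proj proj_zsmul)
open Summit.QuantumFields.BalabanUV.Beta.TameKernelCalculus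
open Summit.QuantumFields.BalabanUV.Beta.BorderedHessian (bhK bhK_inl_inl bhK_inl_inr bhK_inr_inl bhK_inr_inr bhK_inl_inl_eq fcol mcol fcol_apply mcol_apply
  comp_bhK_inl comp_bhK_inr sgnK comp_sgnK sgnK_eq_self trK_bhK contourSumAdj_zero contourSum_zero curvAdj_curv_zero)
open Summit.QuantumFields.BalabanUV.Beta.SymmetrisedAxialGaugeBlockMean
open Summit.QuantumFields.BalabanUV.Beta.SymmetrisedDressingMatrix
open Summit.QuantumFields.BalabanUV.Beta.SymmetrisedDressingKernel
open Summit.QuantumFields.BalabanUV.Beta.SymGaugeMultiplierBlockMean (bondIndR_eq_delta1)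

variable {d : ℕ}

/-! ## §1 The columns of `Π̂_sym` and `curv ∘ Π^{sym}_bm = curv` -/

/-- [folklore] The (windowless) matrix entry of `piKSymBm` IS the matrix of `Π^{sym}_bm` (in-block root): `piKSymBm ρ N z y (inl β) (inl l) = (Π^{sym}_bm δ_{(β,z)})_l(y)`. -/
theorem piKSymBm_inl_inl_eq' {N : ℕ} (hN : 1 ≤ N) {r : Fin (d + 1) → ℕ} (hr : r ∈ box (d + 1) N) (z y : Fin (d + 1) → ℤ) (β l : Fin (d + 1)) :
    piKSymBm (toSite r) N z y (Sum.inl β) (Sum.inl l) = symAxProjBmAt (toSite r) N (delta1 β z) l y := by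
  rw [piKSymBm_inl_inl_eq hN hr, pmSymBm, bondIndR_eq_delta1]

/-- [folklore] **THE FIELD COLUMN OF `Π̂_sym` AT `(inl β, z)` IS `Π^{sym}_bm δ_{(β,z)}`.** -/
theorem fcol_trK_piKSymBm_inl {N : ℕ} (hN : 1 ≤ N) {r : Fin (d + 1) → ℕ} (hr : r ∈ box (d + 1) N) (z : Fin (d + 1) → ℤ) (β : Fin (d + 1)) :
    fcol (trK (piKSymBm (toSite r) N)) z (Sum.inl β) = symAxProjBmAt (toSite r) N (delta1 β z) := by
  funext l y
  rw [fcol_apply, trK_apply, piKSymBm_inl_inl_eq' hN hr]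

/-- [folklore] The field column of `Π̂_sym` at a multiplier index vanishes. -/
theorem fcol_trK_piKSymBm_inr (ρ : Fin (d + 1) → ℤ) (N : ℕ) (z : Fin (d + 1) → ℤ) (β : Fin (d + 1)) :
    fcol (trK (piKSymBm ρ N)) z (Sum.inr β) = 0 := by
  funext l y
  rw [fcol_apply, trK_apply, piKSymBm_inr_inl]
  rfl

/-- [folklore] The multiplier column of `Π̂_sym` at a field index vanishes. -/
theorem mcol_trK_piKSymBm_inl (ρ : Fin (d + 1) → ℤ) (N : ℕ) (z : Fin (d + 1) → ℤ) (β : Fin (d + 1)) :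
    mcol N (trK (piKSymBm ρ N)) z (Sum.inl β) = 0 := by
  funext l y'
  rw [mcol_apply, trK_apply, piKSymBm_inl_inr]
  rfl

/-- [folklore] The multiplier column of `Π̂_sym` at `(inr β, z)` for a coarse `z`: the coarse indicator `δ_{(β, quo z)}`. -/
theorem mcol_trK_piKSymBm_inr_of_coarse {N : ℕ} [NeZero N] (ρ : Fin (d + 1) → ℤ) {z : Fin (d + 1) → ℤ} (hz : Torus.proj N z = 0)
    (β : Fin (d + 1)) : mcol N (trK (piKSymBm ρ N)) z (Sum.inr β) = delta1 β (quo N z) := by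
  funext l y'
  rw [mcol_apply, trK_apply, piKSymBm_inr_inr, delta1_apply]
  have hzq : z = (N : ℤ) • quo N z := eq_zsmul_quo_of_proj hz
  by_cases h : l = β ∧ y' = quo N z
  · obtain ⟨rfl, rfl⟩ := h
    rw [if_pos ⟨hzq, rfl⟩, if_pos ⟨rfl, rfl⟩]
  · rw [if_neg h, if_neg]
    rintro ⟨hzy, hβl⟩
    refine h ⟨hβl.symm, ?_⟩
    rw [hzy, quo_zsmul]

/-- [folklore] … and for a non-coarse `z` it vanishes. -/
theorem mcol_trK_piKSymBm_inr_of_not_coarse {N : ℕ} [NeZero N] (ρ : Fin (d + 1) → ℤ) {z : Fin (d + 1) → ℤ} (hz : Torus.proj N z ≠ 0)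
    (β : Fin (d + 1)) : mcol N (trK (piKSymBm ρ N)) z (Sum.inr β) = 0 := by
  funext l y'
  rw [mcol_apply, trK_apply, piKSymBm_inr_inr, if_neg]
  · rfl
  · rintro ⟨hzy, -⟩
    exact hz (by rw [hzy]; exact proj_zsmul y')

/-- [folklore] **`curv (Π^{sym}_bm A) = curv A`**: the symmetrised dressing is a gradient correction, killed by `curv`. -/
theorem curv_symAxProjBmAt (ρ : Site (d + 1)) (N : ℕ) (A : Form1 (d + 1) ℝ) : curv (symAxProjBmAt ρ N A) = curv A := by
  unfold symAxProjBmAt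
  rw [curv_sub, grad_eq_dz, curv_dz, sub_zero]

/-! ## §2 Right blindness: `bhK N ∘ Π̂_sym = bhK N` -/

/-- [folklore] **RIGHT BLINDNESS OF THE BORDERED HESSIAN TO THE SYMMETRISED DRESSING**: `comp (bhK N) (trK (piKSymBm (toSite r) N)) = bhK N` (in-block root). -/
theorem comp_bhK_trK_piKSymBm {N : ℕ} [NeZero N] {r : Fin (d + 1) → ℕ} (hr : r ∈ box (d + 1) N) :
    comp (bhK N) (trK (piKSymBm (toSite r) N)) = bhK (d := d) N := by
  have hN : 1 ≤ N := Nat.one_le_iff_ne_zero.mpr (NeZero.ne N)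
  funext x z a b
  rcases a with κ | κ <;> rcases b with β | β
  · rw [comp_bhK_inl, fcol_trK_piKSymBm_inl hN hr, mcol_trK_piKSymBm_inl, contourSumAdj_zero, curv_symAxProjBmAt, bhK_inl_inl_eq]
    simp
  · rw [comp_bhK_inl, fcol_trK_piKSymBm_inr, curvAdj_curv_zero, bhK_inl_inr]
    by_cases hz : Torus.proj N z = 0
    · rw [mcol_trK_piKSymBm_inr_of_coarse _ hz, if_pos hz]; simp
    · rw [mcol_trK_piKSymBm_inr_of_not_coarse _ hz, contourSumAdj_zero, if_neg hz]; simp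
  · rw [comp_bhK_inr, fcol_trK_piKSymBm_inl hN hr, contourSum_symAxProjBmAt _ hN, bhK_inr_inl]
  · rw [comp_bhK_inr, fcol_trK_piKSymBm_inr, contourSum_zero, bhK_inr_inr]
    split_ifs <;> rfl

/-! ## §3 Left blindness by transposition -/

/-- [folklore] `piKSymBm` has vanishing mixed blocks, so `sgnK` fixes its transpose. -/
theorem sgnK_trK_piKSymBm (ρ : Fin (d + 1) → ℤ) (N : ℕ) : sgnK (trK (piKSymBm ρ N)) = trK (piKSymBm (d := d) ρ N) :=
  sgnK_eq_self (fun x y κ l => by rw [trK_apply, piKSymBm_inr_inl]) (fun x y κ l => by rw [trK_apply, piKSymBm_inl_inr])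

/-- [folklore] **LEFT BLINDNESS**: `comp (piKSymBm (toSite r) N) (bhK N) = bhK N`. -/
theorem comp_piKSymBm_bhK {N : ℕ} [NeZero N] {r : Fin (d + 1) → ℕ} (hr : r ∈ box (d + 1) N) :
    comp (piKSymBm (toSite r) N) (bhK N) = bhK (d := d) N := by
  have h : trK (comp (piKSymBm (toSite r) N) (bhK N)) = trK (bhK (d := d) N) := by
    rw [trK_comp, trK_bhK, ← sgnK_trK_piKSymBm, comp_sgnK, comp_bhK_trK_piKSymBm hr]
  have h' := congrArg trK h
  rwa [trK_trK, trK_trK] at h'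

end

end Summit.QuantumFields.BalabanUV.Beta.SymBorderedHessianBlind
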